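import Summits.AtomisticToContinuum.FouriersLaw.Theorems.ParityLiouvilleSeedLiouvilleForHeatObservables

/-!
# Stationarity for unbounded local observables of the infinite chain, III: bond independence of the mean current

Helper file (`--supports stmt-AtomisticToContinuum-13980`, route `ParityLiouvilleSeed`, decl
`LiouvilleForHeat`). From the two stationarity identities of Part II
(`…LiouvilleForHeatObservables`): writing `A_x = ∫ p_x V'(r_x) dν`, `B_x = ∫ p_{x+1} V'(r_x) dν`
(`r_x = q_{x+1} - q_x`), the bond-energy identity gives `B_x = A_x`, the on-site-energy identity gives
`A_x = B_{x-1}`, and `∫ j_x dν = -(A_x + B_x)/2 = -A_x`; hence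

* `integral_bondCurrentZ_eq_integral_bondCurrentZ_zero` — **in a time-invariant state of the infinite
  pinned anharmonic chain with all site moments the mean energy current is the same through every
  bond, `∫ j_x dν = ∫ j_0 dν` (`x ∈ ℤ`), with NO shift invariance assumed** — the continuity-equation
  input `ν(j_k) = ν(j_0)` of `CesaroUpgrade` (stmt-13981) / `WindowLimit` (stmt-13982) and of every
  direct attack on `LiouvilleForHeat` (stmt-13980);
* `integral_bondCurrentZ_eq_of_isTimeInvariant` — the same under the translation-BOUNDED moment
  hypothesis of `LiouvilleForHeat`, verbatim;
* `integral_bondCurrentZ_zero_map_shift(_iterate)` — every translate `ν ∘ τ^{-k}` of the state (again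
  time invariant with all site moments) carries the same mean current `∫ j_0`: the terms of a Cesàro
  average over translations all have the mean current of `ν` (first step of `CesaroUpgrade`);
* three more stationarity identities of the same kind: mean momenta vanish (`𝒜q_x = p_x`), mean
  forces vanish (`𝒜p_x = F_x`), and the virial identity `∫ (p_x² + q_x F_x) dν = 0` (`𝒜(q_x p_x)`).

Everything is folklore; nothing here closes an item (the item itself — zero mean current — is the
open odd-sector rigidity problem, SpohnLebowitz1977 §7(iii)).
-/

noncomputable section

open MeasureTheory Filter Topology Set

namespace Summit.AtomisticToContinuum.FouriersLaw.Theorems.ParityLiouvilleSeed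

open Literature.MathematicalPhysics.KineticTheory.HeatConduction

section PinnedChain

variable (ω₂ lam β γ : ℝ) {ν : Measure ChainConfig}

/-! ### Bond independence of the mean current -/

/-- `∫ p_{x+1} V'(q_{x+1} - q_x) dν = ∫ p_x V'(q_{x+1} - q_x) dν` (from the bond-energy identity).
[folklore] -/
theorem integral_momentum_succ_mul_deriv_V (hν : IsTimeInvariant (pinnedChain ω₂ lam β γ) ν)
    (hmom : ∀ (m : ℕ) (x : ℤ), Integrable (fun σ : ChainConfig => |(σ x).1| ^ m + |(σ x).2| ^ m) ν)
    (x : ℤ) :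
    ∫ σ, (σ (x + 1)).2 * deriv (pinnedChain ω₂ lam β γ).V ((σ (x + 1)).1 - (σ x).1) ∂ν =
      ∫ σ, (σ x).2 * deriv (pinnedChain ω₂ lam β γ).V ((σ (x + 1)).1 - (σ x).1) ∂ν := by
  have hB : Integrable (fun σ : ChainConfig => (σ (x + 1)).2 * deriv (pinnedChain ω₂ lam β γ).V ((σ (x + 1)).1 - (σ x).1)) ν :=
    integrable_mul_of_moments (moments_momentum hmom (x + 1)) (moments_deriv_V ω₂ lam β γ hmom x)
  have hA : Integrable (fun σ : ChainConfig => (σ x).2 * deriv (pinnedChain ω₂ lam β γ).V ((σ (x + 1)).1 - (σ x).1)) ν :=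
    integrable_mul_of_moments (moments_momentum hmom x) (moments_deriv_V ω₂ lam β γ hmom x)
  have h0 := integral_deriv_V_mul_momentum_sub_eq_zero ω₂ lam β γ hν hmom x
  have hsplit : ∫ σ, deriv (pinnedChain ω₂ lam β γ).V ((σ (x + 1)).1 - (σ x).1) * ((σ (x + 1)).2 - (σ x).2) ∂ν =
      ∫ σ, (σ (x + 1)).2 * deriv (pinnedChain ω₂ lam β γ).V ((σ (x + 1)).1 - (σ x).1) ∂ν -
        ∫ σ, (σ x).2 * deriv (pinnedChain ω₂ lam β γ).V ((σ (x + 1)).1 - (σ x).1) ∂ν := by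
    rw [← integral_sub hB hA]
    refine integral_congr_ae (Eventually.of_forall fun σ => ?_)
    simp only
    ring
  rw [hsplit] at h0
  linarith

/-- `∫ p_x V'(q_{x+1} - q_x) dν = ∫ p_x V'(q_x - q_{x-1}) dν` (from the on-site-energy identity).
[folklore] -/
theorem integral_momentum_mul_deriv_V_eq_left (hν : IsTimeInvariant (pinnedChain ω₂ lam β γ) ν)
    (hmom : ∀ (m : ℕ) (x : ℤ), Integrable (fun σ : ChainConfig => |(σ x).1| ^ m + |(σ x).2| ^ m) ν)
    (x : ℤ) :
    ∫ σ, (σ x).2 * deriv (pinnedChain ω₂ lam β γ).V ((σ (x + 1)).1 - (σ x).1) ∂ν =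
      ∫ σ, (σ x).2 * deriv (pinnedChain ω₂ lam β γ).V ((σ x).1 - (σ (x - 1)).1) ∂ν := by
  have hA : Integrable (fun σ : ChainConfig => (σ x).2 * deriv (pinnedChain ω₂ lam β γ).V ((σ (x + 1)).1 - (σ x).1)) ν :=
    integrable_mul_of_moments (moments_momentum hmom x) (moments_deriv_V ω₂ lam β γ hmom x)
  have hL : Integrable (fun σ : ChainConfig => (σ x).2 * deriv (pinnedChain ω₂ lam β γ).V ((σ x).1 - (σ (x - 1)).1)) ν :=
    integrable_mul_of_moments (moments_momentum hmom x) (moments_deriv_V_left ω₂ lam β γ hmom x)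
  have h0 := integral_momentum_mul_deriv_V_sub_eq_zero ω₂ lam β γ hν hmom x
  have hsplit : ∫ σ, (σ x).2 * (deriv (pinnedChain ω₂ lam β γ).V ((σ (x + 1)).1 - (σ x).1) -
      deriv (pinnedChain ω₂ lam β γ).V ((σ x).1 - (σ (x - 1)).1)) ∂ν =
      ∫ σ, (σ x).2 * deriv (pinnedChain ω₂ lam β γ).V ((σ (x + 1)).1 - (σ x).1) ∂ν -
        ∫ σ, (σ x).2 * deriv (pinnedChain ω₂ lam β γ).V ((σ x).1 - (σ (x - 1)).1) ∂ν := by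
    rw [← integral_sub hA hL]
    refine integral_congr_ae (Eventually.of_forall fun σ => ?_)
    simp only
    ring
  rw [hsplit] at h0
  linarith

/-- The bond current `j_x` is integrable under the site-moment hypothesis. [folklore] -/
theorem integrable_bondCurrentZ_of_moments
    (hmom : ∀ (m : ℕ) (x : ℤ), Integrable (fun σ : ChainConfig => |(σ x).1| ^ m + |(σ x).2| ^ m) ν)
    (x : ℤ) : Integrable (fun σ : ChainConfig => (pinnedChain ω₂ lam β γ).bondCurrentZ σ x) ν := by
  have h := moments_neg (moments_mul (moments_const_mul
    (moments_add (moments_momentum hmom x) (moments_momentum hmom (x + 1))) (1 / 2))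
    (moments_deriv_V ω₂ lam β γ hmom x))
  refine (integrable_of_moments h).congr (Eventually.of_forall fun σ => ?_)
  simp only [OscillatorChain.bondCurrentZ]
  ring

/-- **The mean current is `-∫ p_x V'(q_{x+1} - q_x) dν`** in a time-invariant state. [folklore] -/
theorem integral_bondCurrentZ_eq_neg (hν : IsTimeInvariant (pinnedChain ω₂ lam β γ) ν)
    (hmom : ∀ (m : ℕ) (x : ℤ), Integrable (fun σ : ChainConfig => |(σ x).1| ^ m + |(σ x).2| ^ m) ν)
    (x : ℤ) :
    ∫ σ, (pinnedChain ω₂ lam β γ).bondCurrentZ σ x ∂ν = -∫ σ, (σ x).2 * deriv (pinnedChain ω₂ lam β γ).V ((σ (x + 1)).1 - (σ x).1) ∂ν := by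
  have hB : Integrable (fun σ : ChainConfig => (σ (x + 1)).2 * deriv (pinnedChain ω₂ lam β γ).V ((σ (x + 1)).1 - (σ x).1)) ν :=
    integrable_mul_of_moments (moments_momentum hmom (x + 1)) (moments_deriv_V ω₂ lam β γ hmom x)
  have hA : Integrable (fun σ : ChainConfig => (σ x).2 * deriv (pinnedChain ω₂ lam β γ).V ((σ (x + 1)).1 - (σ x).1)) ν :=
    integrable_mul_of_moments (moments_momentum hmom x) (moments_deriv_V ω₂ lam β γ hmom x)
  have hj : (fun σ : ChainConfig => (pinnedChain ω₂ lam β γ).bondCurrentZ σ x) = fun σ =>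
      (-(1 / 2 : ℝ)) * ((σ x).2 * deriv (pinnedChain ω₂ lam β γ).V ((σ (x + 1)).1 - (σ x).1) +
        (σ (x + 1)).2 * deriv (pinnedChain ω₂ lam β γ).V ((σ (x + 1)).1 - (σ x).1)) := by
    funext σ
    simp only [OscillatorChain.bondCurrentZ]
    ring
  rw [hj, integral_const_mul, integral_add hA hB, integral_momentum_succ_mul_deriv_V ω₂ lam β γ hν hmom x]
  ring

/-- **Bond independence, one step**: `∫ j_{x+1} dν = ∫ j_x dν`. [folklore] -/
theorem integral_bondCurrentZ_succ (hν : IsTimeInvariant (pinnedChain ω₂ lam β γ) ν)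
    (hmom : ∀ (m : ℕ) (x : ℤ), Integrable (fun σ : ChainConfig => |(σ x).1| ^ m + |(σ x).2| ^ m) ν)
    (x : ℤ) :
    ∫ σ, (pinnedChain ω₂ lam β γ).bondCurrentZ σ (x + 1) ∂ν = ∫ σ, (pinnedChain ω₂ lam β γ).bondCurrentZ σ x ∂ν := by
  rw [integral_bondCurrentZ_eq_neg ω₂ lam β γ hν hmom (x + 1),
    integral_bondCurrentZ_eq_neg ω₂ lam β γ hν hmom x,
    integral_momentum_mul_deriv_V_eq_left ω₂ lam β γ hν hmom (x + 1)]
  simp only [add_sub_cancel_right]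
  rw [integral_momentum_succ_mul_deriv_V ω₂ lam β γ hν hmom x]

/-- **Bond independence of the mean current (continuity equation).** In a state of the infinite
pinned anharmonic chain that is time invariant in the generator sense and has all site moments, the
mean energy current is the same through every bond: `∫ j_x dν = ∫ j_0 dν` for all `x ∈ ℤ` — with NO
shift invariance assumed. This is the input `ν(j_k) = ν(j_0)` of the glue items `CesaroUpgrade` /
`WindowLimit` and of every direct attack on `LiouvilleForHeat`. [folklore] -/
theorem integral_bondCurrentZ_eq_integral_bondCurrentZ_zero (hν : IsTimeInvariant (pinnedChain ω₂ lam β γ) ν)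
    (hmom : ∀ (m : ℕ) (x : ℤ), Integrable (fun σ : ChainConfig => |(σ x).1| ^ m + |(σ x).2| ^ m) ν)
    (x : ℤ) :
    ∫ σ, (pinnedChain ω₂ lam β γ).bondCurrentZ σ x ∂ν = ∫ σ, (pinnedChain ω₂ lam β γ).bondCurrentZ σ 0 ∂ν := by
  induction x using Int.induction_on with
  | zero => rfl
  | succ n ih => rw [← ih]; exact integral_bondCurrentZ_succ ω₂ lam β γ hν hmom (n : ℤ)
  | pred n ih =>
      have h := integral_bondCurrentZ_succ ω₂ lam β γ hν hmom (-(n : ℤ) - 1)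
      rw [sub_add_cancel] at h
      rw [← ih, h]

/-- The same, with the translation-BOUNDED moment hypothesis of `LiouvilleForHeat` /
`WindowLimit` (`∀ m, ∃ C, ∀ x, |q_x|ᵐ + |p_x|ᵐ ∈ L¹(ν) ∧ ∫ ≤ C`). [folklore] -/
theorem integral_bondCurrentZ_eq_of_isTimeInvariant (hν : IsTimeInvariant (pinnedChain ω₂ lam β γ) ν)
    (hmom : ∀ m : ℕ, ∃ C : ℝ, ∀ x : ℤ,
      Integrable (fun σ : ChainConfig => |(σ x).1| ^ m + |(σ x).2| ^ m) ν ∧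
        ∫ σ, (|(σ x).1| ^ m + |(σ x).2| ^ m) ∂ν ≤ C)
    (x : ℤ) :
    ∫ σ, (pinnedChain ω₂ lam β γ).bondCurrentZ σ x ∂ν = ∫ σ, (pinnedChain ω₂ lam β γ).bondCurrentZ σ 0 ∂ν :=
  integral_bondCurrentZ_eq_integral_bondCurrentZ_zero ω₂ lam β γ hν
    (fun m x => by obtain ⟨C, hC⟩ := hmom m; exact (hC x).1) x

/-! ### Mean current under shifts of the state -/

/-- The hypotheses "time invariant with all site moments" are stable under the shift of the state.
[folklore] -/
theorem moments_map_shift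
    (hmom : ∀ (m : ℕ) (x : ℤ), Integrable (fun σ : ChainConfig => |(σ x).1| ^ m + |(σ x).2| ^ m) ν) :
    ∀ (m : ℕ) (x : ℤ), Integrable (fun σ : ChainConfig => |(σ x).1| ^ m + |(σ x).2| ^ m) (ν.map shift) := by
  intro m x
  rw [← coe_shiftEquiv, integrable_map_equiv shiftEquiv]
  exact hmom m (x + 1)

/-- **The shifted state carries the same mean current**: `∫ j_0 d(ν ∘ τ⁻¹) = ∫ j_1 dν = ∫ j_0 dν` for a
time-invariant state with all site moments. [folklore] -/
theorem integral_bondCurrentZ_zero_map_shift (hν : IsTimeInvariant (pinnedChain ω₂ lam β γ) ν)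
    (hmom : ∀ (m : ℕ) (x : ℤ), Integrable (fun σ : ChainConfig => |(σ x).1| ^ m + |(σ x).2| ^ m) ν) :
    ∫ σ, (pinnedChain ω₂ lam β γ).bondCurrentZ σ 0 ∂(ν.map shift) = ∫ σ, (pinnedChain ω₂ lam β γ).bondCurrentZ σ 0 ∂ν := by
  rw [← coe_shiftEquiv, integral_map_equiv shiftEquiv]
  simp only [coe_shiftEquiv, bondCurrentZ_shift, zero_add]
  exact integral_bondCurrentZ_eq_integral_bondCurrentZ_zero ω₂ lam β γ hν hmom 1

/-- The same for all iterates of the shift: `∫ j_0 d(ν ∘ τ^{-k}) = ∫ j_0 dν` — the mean current of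
every term of a Cesàro average over translations is that of `ν` (input of `CesaroUpgrade`).
[folklore] -/
theorem integral_bondCurrentZ_zero_map_shift_iterate (hν : IsTimeInvariant (pinnedChain ω₂ lam β γ) ν)
    (hmom : ∀ (m : ℕ) (x : ℤ), Integrable (fun σ : ChainConfig => |(σ x).1| ^ m + |(σ x).2| ^ m) ν)
    (k : ℕ) :
    ∫ σ, (pinnedChain ω₂ lam β γ).bondCurrentZ σ 0 ∂(ν.map (shift^[k])) = ∫ σ, (pinnedChain ω₂ lam β γ).bondCurrentZ σ 0 ∂ν := by
  induction k generalizing ν with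
  | zero => simp
  | succ k ih =>
      rw [Function.iterate_succ, ← Measure.map_map (shift_measurable.iterate k) shift_measurable,
        ih hν.map_shift (moments_map_shift hmom)]
      exact integral_bondCurrentZ_zero_map_shift ω₂ lam β γ hν hmom

/-! ### Three more stationarity identities: mean momentum, mean force, virial -/

/-- **Mean momenta vanish**: `∫ p_x dν = 0` (`𝒜 q_x = p_x`). [folklore] -/
theorem integral_momentum_eq_zero (hν : IsTimeInvariant (pinnedChain ω₂ lam β γ) ν)
    (hmom : ∀ (m : ℕ) (x : ℤ), Integrable (fun σ : ChainConfig => |(σ x).1| ^ m + |(σ x).2| ^ m) ν)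
    (x : ℤ) : ∫ σ, (σ x).2 ∂ν = 0 := by
  have h0 : ∀ y : Fin (0 + 1) → ℝ × ℝ, HasFDerivAt (fun y : Fin (0 + 1) → ℝ × ℝ => (y 0).1)
      ((ContinuousLinearMap.fst ℝ ℝ ℝ).comp
        (ContinuousLinearMap.proj (R := ℝ) (φ := fun _ : Fin (0 + 1) => ℝ × ℝ) 0)) y :=
    fun y => (hasFDerivAt_apply 0 y).fst
  have hformula : ∀ σ, liouvilleZ (pinnedChain ω₂ lam β γ) ((fun y : Fin (0 + 1) → ℝ × ℝ => (y 0).1) ∘ boxRestrictAt x 0) σ =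
      (σ x).2 := fun σ => by
    rw [liouvilleZ_comp_boxRestrictAt _ x 0 σ (h0 _).differentiableAt, (h0 _).fderiv]
    simp
  have hfun : (fun σ : ChainConfig => (σ x).2) =
      liouvilleZ (pinnedChain ω₂ lam β γ) ((fun y : Fin (0 + 1) → ℝ × ℝ => (y 0).1) ∘ boxRestrictAt x 0) :=
    funext fun σ => (hformula σ).symm
  have hint : Integrable (fun σ : ChainConfig => (σ x).2) ν := integrable_of_moments (moments_momentum hmom x)
  rw [hfun] at hint ⊢
  have hcd : ContDiff ℝ 1 (fun y : Fin (0 + 1) → ℝ × ℝ => (y 0).1) := by fun_prop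
  refine integral_liouvilleZ_comp_boxRestrictAt_eq_zero (pinnedChain ω₂ lam β γ) hν x 0 hcd hint ?_
  have henv : Integrable (fun σ : ChainConfig => |(σ x).1| * (|(σ x).2| + |(pinnedChain ω₂ lam β γ).force σ x|)) ν :=
    integrable_of_moments (moments_mul (moments_abs (moments_position hmom x))
      (moments_add (moments_abs (moments_momentum hmom x)) (moments_abs (moments_force ω₂ lam β γ hmom x))))
  refine henv.congr (Eventually.of_forall fun σ => ?_)
  simp

/-- **Mean forces vanish**: `∫ F_x dν = 0` (`𝒜 p_x = F_x`). [folklore] -/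
theorem integral_force_eq_zero (hν : IsTimeInvariant (pinnedChain ω₂ lam β γ) ν)
    (hmom : ∀ (m : ℕ) (x : ℤ), Integrable (fun σ : ChainConfig => |(σ x).1| ^ m + |(σ x).2| ^ m) ν)
    (x : ℤ) : ∫ σ, (pinnedChain ω₂ lam β γ).force σ x ∂ν = 0 := by
  have h0 : ∀ y : Fin (0 + 1) → ℝ × ℝ, HasFDerivAt (fun y : Fin (0 + 1) → ℝ × ℝ => (y 0).2)
      ((ContinuousLinearMap.snd ℝ ℝ ℝ).comp
        (ContinuousLinearMap.proj (R := ℝ) (φ := fun _ : Fin (0 + 1) => ℝ × ℝ) 0)) y :=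
    fun y => (hasFDerivAt_apply 0 y).snd
  have hformula : ∀ σ, liouvilleZ (pinnedChain ω₂ lam β γ) ((fun y : Fin (0 + 1) → ℝ × ℝ => (y 0).2) ∘ boxRestrictAt x 0) σ =
      (pinnedChain ω₂ lam β γ).force σ x := fun σ => by
    rw [liouvilleZ_comp_boxRestrictAt _ x 0 σ (h0 _).differentiableAt, (h0 _).fderiv]
    simp
  have hfun : (fun σ : ChainConfig => (pinnedChain ω₂ lam β γ).force σ x) =
      liouvilleZ (pinnedChain ω₂ lam β γ) ((fun y : Fin (0 + 1) → ℝ × ℝ => (y 0).2) ∘ boxRestrictAt x 0) :=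
    funext fun σ => (hformula σ).symm
  have hint : Integrable (fun σ : ChainConfig => (pinnedChain ω₂ lam β γ).force σ x) ν :=
    integrable_of_moments (moments_force ω₂ lam β γ hmom x)
  rw [hfun] at hint ⊢
  have hcd : ContDiff ℝ 1 (fun y : Fin (0 + 1) → ℝ × ℝ => (y 0).2) := by fun_prop
  refine integral_liouvilleZ_comp_boxRestrictAt_eq_zero (pinnedChain ω₂ lam β γ) hν x 0 hcd hint ?_
  have henv : Integrable (fun σ : ChainConfig => |(σ x).2| * (|(σ x).2| + |(pinnedChain ω₂ lam β γ).force σ x|)) ν :=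
    integrable_of_moments (moments_mul (moments_abs (moments_momentum hmom x))
      (moments_add (moments_abs (moments_momentum hmom x)) (moments_abs (moments_force ω₂ lam β γ hmom x))))
  refine henv.congr (Eventually.of_forall fun σ => ?_)
  simp

/-- **Virial identity**: `∫ (p_x² + q_x F_x) dν = 0` (`𝒜(q_x p_x) = p_x² + q_x F_x`). [folklore] -/
theorem integral_virial_eq_zero (hν : IsTimeInvariant (pinnedChain ω₂ lam β γ) ν)
    (hmom : ∀ (m : ℕ) (x : ℤ), Integrable (fun σ : ChainConfig => |(σ x).1| ^ m + |(σ x).2| ^ m) ν)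
    (x : ℤ) : ∫ σ, ((σ x).2 ^ 2 + (σ x).1 * (pinnedChain ω₂ lam β γ).force σ x) ∂ν = 0 := by
  have h0 : ∀ y : Fin (0 + 1) → ℝ × ℝ, HasFDerivAt (fun y : Fin (0 + 1) → ℝ × ℝ => (y 0).1 * (y 0).2)
      ((y 0).1 • ((ContinuousLinearMap.snd ℝ ℝ ℝ).comp
        (ContinuousLinearMap.proj (R := ℝ) (φ := fun _ : Fin (0 + 1) => ℝ × ℝ) 0)) +
        (y 0).2 • ((ContinuousLinearMap.fst ℝ ℝ ℝ).comp
          (ContinuousLinearMap.proj (R := ℝ) (φ := fun _ : Fin (0 + 1) => ℝ × ℝ) 0))) y :=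
    fun y => ((hasFDerivAt_apply 0 y).fst).mul ((hasFDerivAt_apply 0 y).snd)
  have hformula : ∀ σ, liouvilleZ (pinnedChain ω₂ lam β γ) ((fun y : Fin (0 + 1) → ℝ × ℝ => (y 0).1 * (y 0).2) ∘
      boxRestrictAt x 0) σ = (σ x).2 ^ 2 + (σ x).1 * (pinnedChain ω₂ lam β γ).force σ x := fun σ => by
    rw [liouvilleZ_comp_boxRestrictAt _ x 0 σ (h0 _).differentiableAt, (h0 _).fderiv]
    simp
    ring
  have hfun : (fun σ : ChainConfig => (σ x).2 ^ 2 + (σ x).1 * (pinnedChain ω₂ lam β γ).force σ x) =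
      liouvilleZ (pinnedChain ω₂ lam β γ) ((fun y : Fin (0 + 1) → ℝ × ℝ => (y 0).1 * (y 0).2) ∘ boxRestrictAt x 0) :=
    funext fun σ => (hformula σ).symm
  have hint : Integrable (fun σ : ChainConfig => (σ x).2 ^ 2 + (σ x).1 * (pinnedChain ω₂ lam β γ).force σ x) ν :=
    integrable_of_moments (moments_add (moments_pow (moments_momentum hmom x) 2)
      (moments_mul (moments_position hmom x) (moments_force ω₂ lam β γ hmom x)))
  have hcd : ContDiff ℝ 1 (fun y : Fin (0 + 1) → ℝ × ℝ => (y 0).1 * (y 0).2) := by fun_prop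
  rw [hfun] at hint ⊢
  refine integral_liouvilleZ_comp_boxRestrictAt_eq_zero (pinnedChain ω₂ lam β γ) hν x 0 hcd hint ?_
  have henv : Integrable (fun σ : ChainConfig => |(σ x).1 * (σ x).2| * (|(σ x).2| + |(pinnedChain ω₂ lam β γ).force σ x|)) ν :=
    integrable_of_moments (moments_mul (moments_abs (moments_mul (moments_position hmom x)
      (moments_momentum hmom x)))
      (moments_add (moments_abs (moments_momentum hmom x)) (moments_abs (moments_force ω₂ lam β γ hmom x))))
  refine henv.congr (Eventually.of_forall fun σ => ?_)
  simp

end PinnedChain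

end Summit.AtomisticToContinuum.FouriersLaw.Theorems.ParityLiouvilleSeed

end
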